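import Literature.Probability.Percolation.ZdFrontierRings
import Literature.Probability.Percolation.ZdFrontierCount
import Literature.Probability.Percolation.ZdFourArmSepNonvacuity
import HarnessLib

/-!
# The fence ring at the tip of a frontier: probability `≥ c⁴` on fresh pairs, and what it gives

Topic `Literature/Probability/Percolation`; bond percolation on `ℤ² = Site 2` at `p = 1/2`.
DEFINITIONS with bodies (`tipOf`, `openRing`, `ringSites`) and PROOFS (no named fact).  A brick
of the EXTERNAL per-scale lemma of Kesten's arm-separation theorem for four alternating arms of
bond percolation on `ℤ²` (H. Kesten, CMP 109 (1987), §2, Lemma 4; P. Nolin, EJP 13 (2008), §4.4,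
Lemma 15 [arXiv 0711.4948: Lemma 14, p. 11]: "by considering a black circuit in the annuli
`S_{2^{l-1},2^l}(z_u)` … we can construct a small extension of `c_u`"), cluster–frontier form:
for a frontier set `S` of `R = [0,M] × [0,N]` (`ZdFrontierEvent.lean`) with TIP
`z = tipOf M N S = (M, t)` (the right end of its lowest crossing), the FENCE RING at scale `ρ`
is the increasing event `openRing M t ρ` that four rectangles around `z` are crossed by open
paths — `H⁺ = [M-2ρ, M+2ρ] × [t+ρ, t+2ρ]` and `H⁻ = [M-2ρ, M+2ρ] × [t-2ρ, t-ρ]` left–right,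
`V^L = [M-2ρ, M-ρ] × [t-2ρ, t+2ρ]` and `V^R = [M+ρ, M+2ρ] × [t-3ρ, t+3ρ]` top–bottom.

* `le_real_openRing` — `P_{1/2}(openRing M t ρ) ≥ c⁴` (RSW at ratio `7`, Harris);
  `determinedBy_openRing` — it is read on the pairs of `ringSites M t ρ` (sites at sup-distance
  between `ρ` and `3ρ` from `z`, in the obvious box), and `disjoint_ringSites_of_le` — the rings
  at scales `ρ` and `ρ' ≥ 4ρ` read disjoint pairs; hence (`ZdFrontierRings.lean`)
  `real_frontierEvent_inter_noFenceRing_le`: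
  **`P(E_S ∩ ⋂_{k<K} (openedOn B_S (openRing M t (r 4^k)))ᶜ) ≤ P(E_S) (1 - c⁴)^K`**;
* `exists_fence_of_mem_openedOn_openRing` — **the deterministic payoff**: on
  `E_S ∩ openedOn B_S (openRing M t ρ)` (lattice `ω`, `2ρ ≤ M`, `3ρ ≤ t ≤ N - 3ρ`) there are, OPEN
  IN `ω`, a top–bottom crossing `V` of `[M+ρ, M+2ρ] × [t-3ρ, t+3ρ]` (the fence) and a walk `P`
  inside `[M-2ρ, M+2ρ] × [t-2ρ, t+2ρ]` from a vertex of `V` to a vertex of `S`, all of whose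
  other vertices are to the right of `R` or above vertices of `↑S`, and whose right-side vertices
  have height `≥ t + ρ` — by the tip catch `LowPath.exists_tipCatch` applied to the lowest
  crossing of the cluster configuration of `S` (whose tip is `z`, `LowPath.b_eq_tipOf`) in the
  completed configuration `ω ∪ B_S`, whose fresh open edges are open in `ω`
  (`mem_of_mem_openedOn_of_fresh`).

## References

* P. Nolin, *Near-critical percolation in two dimensions*, EJP 13 (2008), §4.2 Def. 7 (fences)
  and §4.4, proof of Lemma 15 (arXiv 0711.4948: Def. 6, Lemma 14, p. 11) [Nolin2008].
* H. Kesten, *Scaling relations for 2D-percolation*, CMP 109 (1987), §2, Lemma 4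
  [KestenScalingCMP1987].
* B. Bollobás, O. Riordan, *Percolation* (2006), Ch. 3, Thm. 8 and Lemma 4 (RSW, Harris)
  [BollobasRiordan2006].

## Tree

`LowPath.exists_tipCatch` (`ZdFrontierTipCatch.lean`); `frontierEvent`, `clusterConfig`,
`belowPairs`, `isAboveVertex_clusterConfig_iff`, `isLowVertex_clusterConfig_iff`,
`not_mem_belowPairs_of_fresh` (`ZdFrontierEvent.lean`); `openedOn`,
`real_frontierEvent_inter_biInter_compl_openedOn_le` (`ZdFrontierRings.lean`); `lrCrossingAt`,
`tbCrossingAt'`, `le_real_lrCrossingAt_of_rsw_ratio`, `le_real_tbCrossingAt'_of_rsw_ratio`,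
`le_real_inter_of_upper`, `determinedBy_openCrossing_image`, `rsw_lowerBound_holds`.
-/

noncomputable section

open SimpleGraph Finset

namespace Literature.Probability.Percolation

open LatticeModels _root_.MeasureTheory

variable {M N : ℕ} {ω : BondConfig (Site 2)} {S : Finset (Sym2 (Site 2))}

/-! ### The tip of a frontier set -/

open Classical in
/-- **The tip of `S`**: the right end of the lowest crossing of the configuration `↑S` (when no
top face is flooded for `↑S` and `M ≥ 1`; junk `0` otherwise).  For a frontier set this is the
unique vertex of `S` on the right side of `R` (`eq_tipOf_of_mem_edgeVerts`), Nolin's extremity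
`z_u`. [cite: Nolin2008, §4.4, proof of Lemma 15 (arXiv 0711.4948: Lemma 14, p. 11)] -/
def tipOf (M N : ℕ) (S : Finset (Sym2 (Site 2))) : Site 2 :=
  if h : (∀ t ∈ dualTopSide M N, t ∉ dualBelowR M N (↑S : BondConfig (Site 2))) ∧ 1 ≤ M then
    (Classical.choice (nonempty_lowPath h.2 h.1)).b
  else 0

namespace LowPath

/-- **Lowest crossings with the same edges have the same tip** (the tip is the only vertex of the
crossing on the right side, `apply_zero_lt_of_ne`). [folklore] -/
theorem b_eq_of_edges_iff (hM : 1 ≤ M) {ω₁ ω₂ : BondConfig (Site 2)} (Λ₁ : LowPath M N ω₁) (Λ₂ : LowPath M N ω₂)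
    (h : ∀ e, e ∈ Λ₁.path.edges ↔ e ∈ Λ₂.path.edges) : Λ₁.b = Λ₂.b := by
  have hnil : ¬ Λ₁.path.Nil := by
    intro hn
    have h1 := Λ₁.left
    have h2 := Λ₁.right
    rw [hn.eq] at h1
    omega
  obtain ⟨e, he, hbe⟩ := (Walk.mem_support_iff_exists_mem_edges_of_not_nil hnil).1 Λ₁.path.end_mem_support
  have hb2 : Λ₁.b ∈ Λ₂.path.support := by
    have he2 := (h e).1 he
    revert hbe he2
    induction e using Sym2.ind with
    | h y y' =>
      intro hbe he2
      rcases Sym2.mem_iff.1 hbe with h' | h'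
      · rw [h']; exact Λ₂.path.fst_mem_support_of_mem_edges he2
      · rw [h']; exact Λ₂.path.snd_mem_support_of_mem_edges he2
  by_contra hne
  have := Λ₂.apply_zero_lt_of_ne hM hb2 hne
  have := Λ₁.right
  omega

/-- The tip of the lowest crossing of `↑S` is `tipOf M N S`. [folklore] -/
theorem b_eq_tipOf_coe (hM : 1 ≤ M) (hT : ∀ t ∈ dualTopSide M N, t ∉ dualBelowR M N (↑S : BondConfig (Site 2)))
    (Λ : LowPath M N (↑S : BondConfig (Site 2))) : Λ.b = tipOf M N S := by
  rw [tipOf, dif_pos ⟨hT, hM⟩]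
  exact b_eq_of_edges_iff hM Λ _ fun e => by rw [Λ.mem_edges_iff, LowPath.mem_edges_iff]

/-- **On the frontier event, the tip of the lowest crossing of the cluster configuration of `S`
is `tipOf M N S`.** [folklore] -/
theorem b_eq_tipOf (hS : IsFrontierSet M N S) (hM : 1 ≤ M) (hω : ω ∈ frontierEvent M N S)
    (Λ : LowPath M N (clusterConfig M N ω S)) : Λ.b = tipOf M N S := by
  obtain ⟨Λ'⟩ := nonempty_lowPath (ω := (↑S : BondConfig (Site 2))) hM hS.2
  rw [← Λ'.b_eq_tipOf_coe hM hS.2]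
  exact b_eq_of_edges_iff hM Λ Λ' fun e => by rw [Λ.mem_edges_iff, Λ'.mem_edges_iff, hω.2, hS.1]

end LowPath

namespace IsFrontierSet

/-- The tip of a frontier set lies on the right side of `R`: `(tipOf M N S) 0 = M`. [folklore] -/
theorem tipOf_apply_zero (hS : IsFrontierSet M N S) (hM : 1 ≤ M) : (tipOf M N S) 0 = M := by
  obtain ⟨Λ⟩ := nonempty_lowPath (ω := (↑S : BondConfig (Site 2))) hM hS.2
  rw [← Λ.b_eq_tipOf_coe hM hS.2]; exact Λ.right

/-- The tip of a frontier set lies in `R`. [folklore] -/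
theorem tipOf_mem_rectangle (hS : IsFrontierSet M N S) (hM : 1 ≤ M) : tipOf M N S ∈ rectangle M N := by
  obtain ⟨Λ⟩ := nonempty_lowPath (ω := (↑S : BondConfig (Site 2))) hM hS.2
  rw [← Λ.b_eq_tipOf_coe hM hS.2]; exact Λ.b_mem_rectangle

/-- The tip of a frontier set is a vertex of it. [folklore] -/
theorem tipOf_mem_edgeVerts (hS : IsFrontierSet M N S) (hM : 1 ≤ M) : tipOf M N S ∈ edgeVerts (↑S : Set (Sym2 (Site 2))) := by
  obtain ⟨Λ⟩ := nonempty_lowPath (ω := (↑S : BondConfig (Site 2))) hM hS.2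
  rw [← Λ.b_eq_tipOf_coe hM hS.2, hS.mem_edgeVerts_iff_mem_support hM Λ]
  exact Λ.path.end_mem_support

/-- **The tip is the only vertex of a frontier set on the right side.** [folklore] -/
theorem eq_tipOf_of_mem_edgeVerts (hS : IsFrontierSet M N S) (hM : 1 ≤ M) {x : Site 2}
    (hx : x ∈ edgeVerts (↑S : Set (Sym2 (Site 2)))) (hx0 : x 0 = M) : x = tipOf M N S := by
  obtain ⟨Λ⟩ := nonempty_lowPath (ω := (↑S : BondConfig (Site 2))) hM hS.2
  rw [← Λ.b_eq_tipOf_coe hM hS.2]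
  by_contra hne
  have := Λ.apply_zero_lt_of_ne hM ((hS.mem_edgeVerts_iff_mem_support hM Λ).1 hx) hne
  omega

end IsFrontierSet

/-! ### The fence ring around `(M, t)` at scale `ρ` -/

/-- **The fence ring at scale `ρ` around the point `(M, t)`**: open left–right crossings of
`H⁺ = [M-2ρ, M+2ρ] × [t+ρ, t+2ρ]` and `H⁻ = [M-2ρ, M+2ρ] × [t-2ρ, t-ρ]`, and open top–bottom
crossings of `V^L = [M-2ρ, M-ρ] × [t-2ρ, t+2ρ]` and `V^R = [M+ρ, M+2ρ] × [t-3ρ, t+3ρ]` (four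
overlapping rectangles surrounding the square of radius `ρ`, as in the RSW construction of
circuits in annuli). [cite: Nolin2008, §4.4, proof of Lemma 15 (arXiv 0711.4948: Lemma 14, p. 11): "a black circuit in the annuli S_{2^{l-1},2^l}(z_u)"] -/
def openRing (M : ℕ) (t : ℤ) (ρ : ℕ) : Set (BondConfig (Site 2)) :=
  lrCrossingAt ![(M : ℤ) - 2 * ρ, t + ρ] (4 * ρ) ρ ∩
    (lrCrossingAt ![(M : ℤ) - 2 * ρ, t - 2 * ρ] (4 * ρ) ρ ∩
      (tbCrossingAt' ![(M : ℤ) - 2 * ρ, t - 2 * ρ] ρ (4 * ρ) ∩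
        tbCrossingAt' ![(M : ℤ) + ρ, t - 3 * ρ] ρ (6 * ρ)))

/-- The fence ring is increasing. [folklore] -/
theorem isUpperSet_openRing (M : ℕ) (t : ℤ) (ρ : ℕ) : IsUpperSet (openRing M t ρ) :=
  (isUpperSet_lrCrossingAt _ _ _).inter ((isUpperSet_lrCrossingAt _ _ _).inter
    ((isUpperSet_tbCrossingAt' _ _ _).inter (isUpperSet_tbCrossingAt' _ _ _)))

/-- The fence ring is measurable. [folklore] -/
theorem measurableSet_openRing (M : ℕ) (t : ℤ) (ρ : ℕ) : MeasurableSet (openRing M t ρ) :=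
  (measurableSet_lrCrossingAt _ _ _).inter ((measurableSet_lrCrossingAt _ _ _).inter
    ((measurableSet_tbCrossingAt' _ _ _).inter (measurableSet_tbCrossingAt' _ _ _)))

/-- **The sites read by the fence ring**: the sites of the box `[M-2ρ, M+2ρ] × [t-3ρ, t+3ρ]` at
horizontal distance `≥ ρ` or vertical distance `≥ ρ` from `(M, t)`. [folklore] -/
def ringSites (M : ℕ) (t : ℤ) (ρ : ℕ) : Finset (Site 2) :=
  (Finset.Icc ![(M : ℤ) - 2 * ρ, t - 3 * ρ] ![(M : ℤ) + 2 * ρ, t + 3 * ρ]).filter fun x =>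
    (M : ℤ) + ρ ≤ x 0 ∨ x 0 + ρ ≤ M ∨ t + ρ ≤ x 1 ∨ x 1 + ρ ≤ t

/-- Coordinates of the sites of `ringSites`. [folklore] -/
theorem mem_ringSites_iff {t : ℤ} {ρ : ℕ} {x : Site 2} : x ∈ ringSites M t ρ ↔
    ((M : ℤ) - 2 * ρ ≤ x 0 ∧ x 0 ≤ M + 2 * ρ ∧ t - 3 * ρ ≤ x 1 ∧ x 1 ≤ t + 3 * ρ) ∧
      ((M : ℤ) + ρ ≤ x 0 ∨ x 0 + ρ ≤ M ∨ t + ρ ≤ x 1 ∨ x 1 + ρ ≤ t) := by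
  rw [ringSites, Finset.mem_filter, Finset.mem_Icc]
  simp only [Pi.le_def, Fin.forall_fin_two, Matrix.cons_val_zero, Matrix.cons_val_one]
  tauto

/-- A translated rectangle inside the ring region reads pairs of `ringSites`. [folklore] -/
theorem image_rectangle_sym2_subset_ringSites {t : ℤ} {ρ : ℕ} {u : Site 2} {w h : ℕ}
    (hu : ∀ z : Site 2, u 0 ≤ z 0 → z 0 ≤ u 0 + w → u 1 ≤ z 1 → z 1 ≤ u 1 + h → z ∈ ringSites M t ρ) :
    (((rectangle w h).image (· + u)).sym2 : Finset (Sym2 (Site 2))) ⊆ (ringSites M t ρ).sym2 := by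
  refine Finset.sym2_mono fun z hz => ?_
  have hz' : z ∈ (· + u) '' (rectangle w h : Set (Site 2)) := by
    rw [← Finset.coe_image]; exact Finset.mem_coe.2 hz
  obtain ⟨h1, h2, h3, h4⟩ := mem_image_rectangle_iff.1 hz'
  exact hu z h1 h2 h3 h4

/-- **The fence ring is read on the pairs of `ringSites`.** [folklore] -/
theorem determinedBy_openRing (M : ℕ) (t : ℤ) (ρ : ℕ) : DeterminedBy (openRing M t ρ) ↑((ringSites M t ρ).sym2) := by
  have hlr : ∀ (u : Site 2) (w h : ℕ), DeterminedBy (lrCrossingAt u w h) ↑(((rectangle w h).image (· + u)).sym2) :=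
    fun u w h => determinedBy_openCrossing_image _ _ _ _
  have htb : ∀ (u : Site 2) (w h : ℕ), DeterminedBy (tbCrossingAt' u w h) ↑(((rectangle w h).image (· + u)).sym2) :=
    fun u w h => determinedBy_openCrossing_image _ _ _ _
  refine ((hlr _ _ _).mono (Finset.coe_subset.2 (image_rectangle_sym2_subset_ringSites fun z h1 h2 h3 h4 => ?_))).inter
    (((hlr _ _ _).mono (Finset.coe_subset.2 (image_rectangle_sym2_subset_ringSites fun z h1 h2 h3 h4 => ?_))).inter
    (((htb _ _ _).mono (Finset.coe_subset.2 (image_rectangle_sym2_subset_ringSites fun z h1 h2 h3 h4 => ?_))).inter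
    ((htb _ _ _).mono (Finset.coe_subset.2 (image_rectangle_sym2_subset_ringSites fun z h1 h2 h3 h4 => ?_)))))
  all_goals
    simp only [Matrix.cons_val_zero, Matrix.cons_val_one, Nat.cast_mul, Nat.cast_ofNat] at h1 h2 h3 h4
    rw [mem_ringSites_iff]
    omega

/-- **Fence rings at scales `ρ` and `ρ' ≥ 4ρ` read disjoint sites.** [folklore] -/
theorem disjoint_ringSites_of_le {t : ℤ} {ρ ρ' : ℕ} (hρ : 1 ≤ ρ) (h : 4 * ρ ≤ ρ') :
    Disjoint (ringSites M t ρ) (ringSites M t ρ') := by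
  rw [Finset.disjoint_left]
  intro x hx hx'
  have h1 := mem_ringSites_iff.1 hx
  have h2 := mem_ringSites_iff.1 hx'
  omega

/-- Fence rings at scales `ρ` and `ρ' ≥ 4ρ` read disjoint pairs. [folklore] -/
theorem disjoint_ringSites_sym2_of_le {t : ℤ} {ρ ρ' : ℕ} (hρ : 1 ≤ ρ) (h : 4 * ρ ≤ ρ') :
    Disjoint (ringSites M t ρ).sym2 (ringSites M t ρ').sym2 := by
  rw [Finset.disjoint_left]
  intro e he he'
  induction e using Sym2.ind with
  | h x y =>
    exact Finset.disjoint_left.1 (disjoint_ringSites_of_le (M := M) (t := t) hρ h) (Finset.mk_mem_sym2_iff.1 he).1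
      (Finset.mk_mem_sym2_iff.1 he').1

/-- The scales `r 4^k`, `k < K`, are pairwise in ratio `≥ 4`. [folklore] -/
theorem disjoint_ringSites_sym2_pow {t : ℤ} {r : ℕ} (hr : 1 ≤ r) {k l : ℕ} (hkl : k ≠ l) :
    Disjoint (ringSites M t (r * 4 ^ k)).sym2 (ringSites M t (r * 4 ^ l)).sym2 := by
  rcases Nat.lt_or_gt_of_ne hkl with hlt | hlt
  · refine disjoint_ringSites_sym2_of_le (Nat.le_mul_of_pos_right _ (by positivity) |>.trans' hr) ?_
    calc 4 * (r * 4 ^ k) = r * 4 ^ (k + 1) := by ring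
      _ ≤ r * 4 ^ l := Nat.mul_le_mul_left _ (Nat.pow_le_pow_right (by norm_num) hlt)
  · refine (disjoint_ringSites_sym2_of_le (Nat.le_mul_of_pos_right _ (by positivity) |>.trans' hr) ?_).symm
    calc 4 * (r * 4 ^ l) = r * 4 ^ (l + 1) := by ring
      _ ≤ r * 4 ^ k := Nat.mul_le_mul_left _ (Nat.pow_le_pow_right (by norm_num) hlt)

/-- **The fence ring has probability at least `c⁴`**, `c` the RSW constant of ratio `7` (each of
the four crossings has aspect ratio at most `6`; Harris). [cite: BollobasRiordan2006, Ch. 3, Thm. 8 and Lemma 4] -/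
theorem le_real_openRing {c : ℝ} (hc0 : 0 ≤ c) (hc : ∀ l : ℕ, 1 ≤ l → c ≤ crossingProb half (7 * l - 1) (l - 1))
    (M : ℕ) (t : ℤ) (ρ : ℕ) : c ^ 4 ≤ (bondPercolation (zdGraph 2) half).real (openRing M t ρ) := by
  have e : c ^ 4 = c * (c * (c * c)) := by ring
  rw [e, openRing]
  have h₁ := le_real_lrCrossingAt_of_rsw_ratio hc ![(M : ℤ) - 2 * ρ, t + ρ] (M := 4 * ρ) (n := ρ) (by omega)
  have h₂ := le_real_lrCrossingAt_of_rsw_ratio hc ![(M : ℤ) - 2 * ρ, t - 2 * ρ] (M := 4 * ρ) (n := ρ) (by omega)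
  have h₃ := le_real_tbCrossingAt'_of_rsw_ratio hc ![(M : ℤ) - 2 * ρ, t - 2 * ρ] (w := ρ) (h := 4 * ρ) (by omega)
  have h₄ := le_real_tbCrossingAt'_of_rsw_ratio hc ![(M : ℤ) + ρ, t - 3 * ρ] (w := ρ) (h := 6 * ρ) (by omega)
  have s₃ := le_real_inter_of_upper hc0 hc0 (isUpperSet_tbCrossingAt' _ _ _) (isUpperSet_tbCrossingAt' _ _ _)
    (measurableSet_tbCrossingAt' _ _ _) (measurableSet_tbCrossingAt' _ _ _) h₃ h₄
  have s₂ := le_real_inter_of_upper hc0 (by positivity) (isUpperSet_lrCrossingAt _ _ _)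
    ((isUpperSet_tbCrossingAt' _ _ _).inter (isUpperSet_tbCrossingAt' _ _ _)) (measurableSet_lrCrossingAt _ _ _)
    ((measurableSet_tbCrossingAt' _ _ _).inter (measurableSet_tbCrossingAt' _ _ _)) h₂ s₃
  exact le_real_inter_of_upper hc0 (by positivity) (isUpperSet_lrCrossingAt _ _ _)
    ((isUpperSet_lrCrossingAt _ _ _).inter ((isUpperSet_tbCrossingAt' _ _ _).inter (isUpperSet_tbCrossingAt' _ _ _)))
    (measurableSet_lrCrossingAt _ _ _)
    ((measurableSet_lrCrossingAt _ _ _).inter ((measurableSet_tbCrossingAt' _ _ _).inter (measurableSet_tbCrossingAt' _ _ _)))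
    h₁ s₂

/-- **No fence ring at any of `K` scales costs `(1 - c⁴)^K` on the frontier event**:
`P_{1/2}(E_S ∩ ⋂_{k<K} (openedOn B_S (openRing M t (r 4^k)))ᶜ) ≤ P_{1/2}(E_S) (1 - c⁴)^K` for any
`t` and `r ≥ 1` (the rings read pairwise disjoint fresh pairs). [cite: Nolin2008, §4.4, proof of Lemma 15 (arXiv 0711.4948: Lemma 14, p. 11)] -/
theorem real_frontierEvent_inter_noFenceRing_le (hS : IsFrontierSet M N S) (hM : 1 ≤ M) {c : ℝ} (hc0 : 0 ≤ c)
    (hc : ∀ l : ℕ, 1 ≤ l → c ≤ crossingProb half (7 * l - 1) (l - 1)) (t : ℤ) {r : ℕ} (hr : 1 ≤ r) (K : ℕ) :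
    (bondPercolation (zdGraph 2) half).real
        (frontierEvent M N S ∩ ⋂ k ∈ Finset.range K, (openedOn (belowPairs M N S) (openRing M t (r * 4 ^ k)))ᶜ) ≤
      (bondPercolation (zdGraph 2) half).real (frontierEvent M N S) * (1 - c ^ 4) ^ K :=
  real_frontierEvent_inter_biInter_compl_openedOn_le half hS hM (fun k => openRing M t (r * 4 ^ k))
    (fun k => (ringSites M t (r * 4 ^ k)).sym2) (fun _ => isUpperSet_openRing _ _ _)
    (fun _ => determinedBy_openRing _ _ _) (fun _ _ hkl => disjoint_ringSites_sym2_pow hr hkl)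
    fun _ _ => le_real_openRing hc0 hc M t _

/-- The RSW constant of ratio `7` (`rsw_lowerBound_holds`). [folklore] -/
theorem exists_rsw_seven : ∃ c : ℝ, 0 < c ∧ ∀ l : ℕ, 1 ≤ l → c ≤ crossingProb half (7 * l - 1) (l - 1) :=
  rsw_lowerBound_holds 7 (by norm_num)

/-! ### The deterministic payoff: fence and fresh open walk to the frontier -/

/-- Below pairs are lattice edges. [folklore] -/
theorem belowPairs_subset_edgeSet : (↑(belowPairs M N S) : Set (Sym2 (Site 2))) ⊆ (zdGraph 2).edgeSet := by
  intro e he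
  obtain ⟨g, -, hge⟩ := mem_belowPairs_iff.1 (Finset.mem_coe.1 he)
  simp only [squareEdges, Finset.mem_insert, Finset.mem_singleton] at hge
  rcases hge with rfl | rfl | rfl | rfl
  · exact adj_of_stepKind (.right (by simp) (by simp))
  · exact adj_of_stepKind (.up (by simp) (by simp))
  · exact adj_of_stepKind (.right (by simp) (by simp))
  · exact adj_of_stepKind (.up (by simp) (by simp))

/-- **On the fence ring read on fresh pairs, the frontier has a fence**: for a lattice
configuration `ω ∈ E_S ∩ openedOn B_S (openRing M t ρ)`, `t = (tipOf M N S)₁`, `ρ ≥ 1`,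
`2ρ ≤ M`, `3ρ ≤ t`, `t + 3ρ ≤ N`, there are an `ω`-OPEN top–bottom crossing `V` of
`[M+ρ, M+2ρ] × [t-3ρ, t+3ρ]` and an `ω`-OPEN walk `P` inside `[M-2ρ, M+2ρ] × [t-2ρ, t+2ρ]` from
a vertex of `V` to a vertex of `S`, whose other vertices lie to the right of `R` or are above
vertices of `↑S`, and whose vertices on the right side of `R` have height `≥ t + ρ`.
[cite: Nolin2008, §4.4, proof of Lemma 15 (arXiv 0711.4948: Lemma 14, p. 11): "we can construct a small extension of c_u"] -/
theorem exists_fence_of_mem_openedOn_openRing (hS : IsFrontierSet M N S) (hM : 1 ≤ M)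
    (hωE : ω ⊆ (zdGraph 2).edgeSet) (hω : ω ∈ frontierEvent M N S) {ρ : ℕ} (hρ : 1 ≤ ρ) (hρM : 2 * ρ ≤ M)
    (hlo : 3 * (ρ : ℤ) ≤ (tipOf M N S) 1) (hhi : (tipOf M N S) 1 + 3 * ρ ≤ N)
    (hring : ω ∈ openedOn (belowPairs M N S) (openRing M ((tipOf M N S) 1) ρ)) :
    ∃ (c d : Site 2) (V : (zdGraph 2).Walk c d), c 1 = (tipOf M N S) 1 - 3 * ρ ∧ d 1 = (tipOf M N S) 1 + 3 * ρ ∧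
      (∀ w ∈ V.support, (M : ℤ) + ρ ≤ w 0 ∧ w 0 ≤ M + 2 * ρ) ∧ (∀ e ∈ V.edges, e ∈ ω) ∧
      ∃ u ∈ V.support, ∃ v ∈ edgeVerts (↑S : Set (Sym2 (Site 2))), ∃ P : (zdGraph 2).Walk u v,
        (∀ w ∈ P.support, (M : ℤ) - 2 * ρ ≤ w 0 ∧ w 0 ≤ M + 2 * ρ ∧
          (tipOf M N S) 1 - 2 * ρ ≤ w 1 ∧ w 1 ≤ (tipOf M N S) 1 + 2 * ρ) ∧
        (∀ e ∈ P.edges, e ∈ ω) ∧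
        (∀ w ∈ P.support, w ≠ v → (M : ℤ) < w 0 ∨ IsAboveVertex M N (↑S : BondConfig (Site 2)) w) ∧
        ∀ w ∈ P.support, w 0 = M → (tipOf M N S) 1 + ρ ≤ w 1 := by
  classical
  -- the lowest crossing of the cluster configuration, its tip
  set K := clusterConfig M N ω S with hK
  have hSK : (↑S : Set (Sym2 (Site 2))) ⊆ K := hS.subset_clusterConfig hω.1
  have hTK : ∀ t ∈ dualTopSide M N, t ∉ dualBelowR M N K := fun t ht htB => hS.2 t ht (dualBelowR_anti hSK htB)
  obtain ⟨Λ⟩ := nonempty_lowPath (ω := K) hM hTK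
  have htip : Λ.b = tipOf M N S := Λ.b_eq_tipOf hS hM hω
  rw [← htip] at hlo hhi hring ⊢
  -- the completed configuration
  set ω' : BondConfig (Site 2) := ω ∪ ↑(belowPairs M N S) with hω'
  have hω'E : ω' ⊆ (zdGraph 2).edgeSet := Set.union_subset hωE belowPairs_subset_edgeSet
  obtain ⟨hHp, hHm, hVl, hVr⟩ := hring
  -- the fence walk
  obtain ⟨c, d, V, hc, hd, hVs, hVe⟩ := exists_walk_of_mem_tbCrossingAt hω'E hVr
  simp only [Matrix.cons_val_zero, Matrix.cons_val_one, Nat.cast_mul, Nat.cast_ofNat] at hc hd hVs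
  -- the tip catch in the completed configuration
  obtain ⟨u, hu, v, hv, P, hPs, hPe, hPf, hPc⟩ := Λ.exists_tipCatch hM hTK hω'E hρ hρM (by omega) (by omega)
    hHp hHm hVl V (fun z hz => by have := hVs z hz; omega) (by omega) (by omega)
  -- freshness: fresh open edges of `ω'` are open in `ω`
  have hfreshE : ∀ {p : Site 2}, (M : ℤ) < p 0 ∨ IsAboveVertex M N K p → ∀ {e : Sym2 (Site 2)},
      e ∈ (zdGraph 2).edgeSet → p ∈ e → e ∈ ω' → e ∈ ω := fun {p} hp {e} he hpe heω' =>
    mem_of_mem_openedOn_of_fresh hS hω hp he hpe heω'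
  refine ⟨c, d, V, by omega, by omega, fun w hw => by have := hVs w hw; omega, fun e he => ?_, u, hu, v, ?_, P, hPs,
    fun e he => ?_, fun w hw hne => ?_, hPc⟩
  · -- edges of `V` are to the right of `R`
    rw [Walk.edges, List.mem_map] at he
    obtain ⟨e', he', rfl⟩ := he
    have h1 := hVs _ (V.dart_fst_mem_support_of_mem_darts he')
    exact hfreshE (Or.inl (by omega)) ((SimpleGraph.mem_edgeSet _).2 e'.adj) (Sym2.mem_mk_left _ _)
      (hVe _ (by rw [Walk.edges]; exact List.mem_map.2 ⟨e', he', rfl⟩))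
  · -- `v` is a vertex of `S`
    exact (isLowVertex_clusterConfig_iff hω).1 ((Λ.mem_support_iff hM).1 hv)
  · -- edges of `P` have a fresh endpoint
    rw [Walk.edges, List.mem_map] at he
    obtain ⟨e', he', rfl⟩ := he
    have hmem : s(e'.fst, e'.snd) ∈ ω' := hPe _ (by rw [Walk.edges]; exact List.mem_map.2 ⟨e', he', rfl⟩)
    by_cases h1 : e'.fst = v
    · have h2 : e'.snd ≠ v := fun h2 => e'.adj.ne (h1.trans h2.symm)
      exact hfreshE (hPf _ (P.dart_snd_mem_support_of_mem_darts he') h2) ((SimpleGraph.mem_edgeSet _).2 e'.adj)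
        (Sym2.mem_mk_right _ _) hmem
    · exact hfreshE (hPf _ (P.dart_fst_mem_support_of_mem_darts he') h1) ((SimpleGraph.mem_edgeSet _).2 e'.adj)
        (Sym2.mem_mk_left _ _) hmem
  · rcases hPf w hw hne with h | h
    · exact Or.inl h
    · exact Or.inr ((isAboveVertex_clusterConfig_iff hS hω).1 h)

end Literature.Probability.Percolation

end
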